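import Literature.AnabelianGeometry.SemiGraphs.TemperoidsGaloisHomTorsor
import HarnessLib

/-!
# [EtTh] Remark 2.15.2: cofinal `ℕ`-indexed projective systems of connected Galois objects of a temperoid are
# isomorphic as projective systems — PROVED at the genuine temperoid `B^temp(Π)` (proof-only)

S. Mochizuki, *The étale theta function and its Frobenioid-theoretic manifestations*, Publ. RIMS **45** (2009)
[MochizukiEtTh2009], §2, Remark 2.15.2, PRIMS PDF p. 53 l. 48–60 (printed p. 279): «Let `T` be a "connected temperoid"
… the temperoid associated to a topological group whose topology admits a countable basis of open subgroups.  Then if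
`A → B` is a morphism of connected Galois objects of `T`, then one verifies immediately that `Aut(A)` acts transitively on
`Hom_T(A, B)`.  In particular, [cf. Proposition 2.15, (ii)] if `A = {A_i}_{i∈ℕ}`, `B = {B_j}_{j∈ℕ}` are cofinal [i.e., among
the connected objects of `T`] projective systems of connected Galois objects of `T` indexed by `ℕ` [equipped with its usual
ordering], then there exists an isomorphism of projective systems `A ⥲ B` [which does not necessarily induce an isomorphism
between the various `A_i`, `B_j`].» [cite: MochizukiEtTh2009, Rmk 2.15.2 p.53]; [SemiAnbd] Def. 3.1 (iv) / Rmk. 3.1.3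
(Galois objects of `B^temp(Π)`) [cite: MochizukiSemiAnbd2006, Rmk 3.1.3 p.34].

PROOF-ONLY (theorems only: no `def`, no instance, no `Prop` fact; abc-iut cell, layer L2, seat abc-iut-L2-t12 gen 10,
row «RMK2152-PROSYSTEMS» offered under L2 ROWS #140).  The FIRST sentence of the remark is abc-iut-w4-d099's kernel
theorem `SemiGraphs.GaloisObjects.exists_aut_comp_eq_of_isGaloisObj` (`SemiGraphs/TemperoidsGaloisHomTorsor.lean`,
p424508: for `A` Galois and `T` CONNECTED in `B^temp(Π)` and `b, b′ : A → T` there is `σ ∈ Aut(A)` with `b′ = σ ≫ b` —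
stronger than print, which takes `B` Galois too; no countability / temperedness hypothesis on `Π` is needed).  THIS FILE
proves the SECOND sentence («[cf. Proposition 2.15, (ii)]») at `B^temp(Π)` for ANY topological group `Π`, with the two
projective systems typed as functors `A B : ℕᵒᵖ ⥤ B^temp(Π)` (transition maps `A.map (homOfLE _).op`):

* `exists_hom_of_cofinal` — a system of CONNECTED objects cofinal among connected objects receives arrows from any other
  such system: `∀ n, ∃ m, Nonempty (A m ⟶ B n)` (the only use of «cofinal»);
* `interleave_step` — ONE STEP of print's induction: given `f : A i ⟶ B j` there are `i < i′`, `j < j′`,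
  `g : B j′ ⟶ A i` and `f′ : A i′ ⟶ B j′` with `g ≫ f =` the transition map `B j′ ⟶ B j` and `f′ ≫ g =` the transition map
  `A i′ ⟶ A i` — an arbitrary cofinality arrow is CORRECTED by an automorphism of its Galois source (first sentence);
* **`exists_interleaving_of_cofinal_galois_systems`** — the second sentence: strictly increasing `i, j : ℕ → ℕ` and
  morphisms `f k : A (i k) ⟶ B (j k)`, `g k : B (j (k+1)) ⟶ A (i k)` INTERLEAVING the two towers
  (`g k ≫ f k = B (j (k+1)) ⟶ B (j k)`, `f (k+1) ≫ g k = A (i (k+1)) ⟶ A (i k)`), i.e. mutually inverse morphisms of the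
  pro-objects `"lim" A`, `"lim" B` — an isomorphism of projective systems «which does not necessarily induce an isomorphism
  between the various `A_i`, `B_j`»;
* `exists_interleaving_of_cofinal_galois_systems'` — the same from print's hypothesis verbatim («cofinal among the connected
  objects»: every connected `T` receives an arrow from some `A n`, resp. `B n`).

HONEST FRAMING: category/group theory at the tree's model of record of a temperoid (`B^temp(Π)`, [SemiAnbd] §3); the remark
has no consumer in the [IUTchIII] Cor. 3.12 cone (print uses it to pass from a temperoid to its fundamental group,
[SemiAnbd] Prop. 3.2); refereed pre-IUT material; nothing here bears on [IUTchIII] Cor. 3.12; no side taken.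
-/

namespace Literature.AnabelianGeometry.EtaleTheta

open CategoryTheory Opposite Literature.AnabelianGeometry.SemiGraphs
open Literature.AlgebraicGeometry.Frobenioids (IsConnectedObj)

universe u

namespace Rmk2152

variable {G : Type u} [Group G] [TopologicalSpace G]

/-- A projective system of CONNECTED objects of `B^temp(Π)` that is cofinal among the connected objects receives an arrow,
at every index of any other ℕ-indexed system of connected objects, from some of its own terms.
[cite: MochizukiEtTh2009, Rmk 2.15.2 p.53] -/
theorem exists_hom_of_cofinal (A B : ℕᵒᵖ ⥤ BTemp G)
    (hAc : ∀ T : BTemp G, IsConnectedObj T → ∃ n : ℕ, Nonempty (A.obj (op n) ⟶ T))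
    (hB : ∀ n : ℕ, IsConnectedObj (B.obj (op n))) (n : ℕ) :
    ∃ m : ℕ, Nonempty (A.obj (op m) ⟶ B.obj (op n)) :=
  hAc _ (hB n)

/-- **One step of the interleaving** (print's «one verifies immediately»): given `f : A i ⟶ B j` between terms of two
ℕ-indexed projective systems of connected GALOIS objects of `B^temp(Π)`, each receiving arrows from the other, there are
`i < i′`, `j < j′`, `g : B j′ ⟶ A i` and `f′ : A i′ ⟶ B j′` such that `g ≫ f` and `f′ ≫ g` are the transition maps —
each cofinality arrow being corrected by an automorphism of its (Galois) source, `Aut` acting transitively on `Hom` into a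
connected object (`GaloisObjects.exists_aut_comp_eq_of_isGaloisObj`). [cite: MochizukiEtTh2009, Rmk 2.15.2 p.53] -/
theorem interleave_step (A B : ℕᵒᵖ ⥤ BTemp G)
    (hA : ∀ n : ℕ, IsGaloisObj (A.obj (op n))) (hB : ∀ n : ℕ, IsGaloisObj (B.obj (op n)))
    (hAB : ∀ n : ℕ, ∃ m : ℕ, Nonempty (A.obj (op m) ⟶ B.obj (op n)))
    (hBA : ∀ n : ℕ, ∃ m : ℕ, Nonempty (B.obj (op m) ⟶ A.obj (op n)))
    (i j : ℕ) (f : A.obj (op i) ⟶ B.obj (op j)) :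
    ∃ (i' j' : ℕ) (hi : i < i') (hj : j < j') (g : B.obj (op j') ⟶ A.obj (op i))
      (f' : A.obj (op i') ⟶ B.obj (op j')),
      g ≫ f = B.map (homOfLE hj.le).op ∧ f' ≫ g = A.map (homOfLE hi.le).op := by
  -- an arrow `B m ⟶ A i`, moved up to an index `j' > j`
  obtain ⟨m, ⟨h⟩⟩ := hBA i
  let j' : ℕ := max m (j + 1)
  have hmj' : m ≤ j' := le_max_left _ _
  have hj : j < j' := lt_of_lt_of_le (Nat.lt_succ_self j) (le_max_right _ _)
  let h₁ : B.obj (op j') ⟶ A.obj (op i) := B.map (homOfLE hmj').op ≫ h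
  -- correct it by an automorphism of the Galois source `B j'` so that the composite with `f` IS the transition map
  obtain ⟨σ, hσ⟩ := GaloisObjects.exists_aut_comp_eq_of_isGaloisObj (B.obj (op j')) (B.obj (op j)) (hB j') (hB j).1
    (h₁ ≫ f) (B.map (homOfLE hj.le).op)
  let g : B.obj (op j') ⟶ A.obj (op i) := σ.hom ≫ h₁
  have hg : g ≫ f = B.map (homOfLE hj.le).op := by rw [hσ, Category.assoc]
  -- an arrow `A m' ⟶ B j'`, moved up to an index `i' > i`, corrected by an automorphism of `A i'`
  obtain ⟨m', ⟨h'⟩⟩ := hAB j'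
  let i' : ℕ := max m' (i + 1)
  have hmi' : m' ≤ i' := le_max_left _ _
  have hi : i < i' := lt_of_lt_of_le (Nat.lt_succ_self i) (le_max_right _ _)
  let h₂ : A.obj (op i') ⟶ B.obj (op j') := A.map (homOfLE hmi').op ≫ h'
  obtain ⟨σ', hσ'⟩ := GaloisObjects.exists_aut_comp_eq_of_isGaloisObj (A.obj (op i')) (A.obj (op i)) (hA i') (hA i).1
    (h₂ ≫ g) (A.map (homOfLE hi.le).op)
  refine ⟨i', j', hi, hj, g, σ'.hom ≫ h₂, hg, ?_⟩
  rw [hσ', Category.assoc]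

/-- **[EtTh] Rmk. 2.15.2, second sentence, at `B^temp(Π)`**: two ℕ-indexed projective systems `A`, `B` of connected Galois
objects of `B^temp(Π)`, each receiving arrows from the other (⟸ both cofinal among connected objects), are ISOMORPHIC AS
PROJECTIVE SYSTEMS: there are strictly increasing reindexings `i, j : ℕ → ℕ` and morphisms `f k : A (i k) ⟶ B (j k)`,
`g k : B (j (k+1)) ⟶ A (i k)` interleaving the two towers — `g k ≫ f k` is the transition map `B (j (k+1)) ⟶ B (j k)` and
`f (k+1) ≫ g k` the transition map `A (i (k+1)) ⟶ A (i k)` — so that `(f k)_k` and `(g k)_k` are mutually inverse morphisms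
of pro-objects «which [do] not necessarily induce an isomorphism between the various `A_i`, `B_j`».
[cite: MochizukiEtTh2009, Rmk 2.15.2 p.53] -/
theorem exists_interleaving_of_cofinal_galois_systems (A B : ℕᵒᵖ ⥤ BTemp G)
    (hA : ∀ n : ℕ, IsGaloisObj (A.obj (op n))) (hB : ∀ n : ℕ, IsGaloisObj (B.obj (op n)))
    (hAB : ∀ n : ℕ, ∃ m : ℕ, Nonempty (A.obj (op m) ⟶ B.obj (op n)))
    (hBA : ∀ n : ℕ, ∃ m : ℕ, Nonempty (B.obj (op m) ⟶ A.obj (op n))) :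
    ∃ (i j : ℕ → ℕ) (hi : StrictMono i) (hj : StrictMono j)
      (f : ∀ k : ℕ, A.obj (op (i k)) ⟶ B.obj (op (j k)))
      (g : ∀ k : ℕ, B.obj (op (j (k + 1))) ⟶ A.obj (op (i k))),
      (∀ k, g k ≫ f k = B.map (homOfLE (hj.monotone (Nat.le_succ k))).op) ∧
      (∀ k, f (k + 1) ≫ g k = A.map (homOfLE (hi.monotone (Nat.le_succ k))).op) := by
  classical
  -- a starting arrow `f₀ : A i₀ ⟶ B 0`
  obtain ⟨i₀, ⟨f₀⟩⟩ := hAB 0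
  -- the stage type `(i, j, f : A i ⟶ B j)` and the successor stage chosen by `interleave_step`
  let S : Type u := Σ p : ℕ × ℕ, (A.obj (op p.1) ⟶ B.obj (op p.2))
  have step : ∀ s : S, ∃ (s' : S) (g : B.obj (op s'.1.2) ⟶ A.obj (op s.1.1)) (hi : s.1.1 < s'.1.1)
      (hj : s.1.2 < s'.1.2), g ≫ s.2 = B.map (homOfLE hj.le).op ∧ s'.2 ≫ g = A.map (homOfLE hi.le).op := by
    rintro ⟨⟨i, j⟩, f⟩
    obtain ⟨i', j', hi, hj, g, f', hgf, hfg⟩ := interleave_step A B hA hB hAB hBA i j f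
    exact ⟨⟨⟨i', j'⟩, f'⟩, g, hi, hj, hgf, hfg⟩
  choose nxt g hlt_i hlt_j hgf hfg using step
  -- the sequence of stages
  let seq : ℕ → S := fun k => Nat.rec (⟨⟨i₀, 0⟩, f₀⟩ : S) (fun _ s => nxt s) k
  have seq_succ : ∀ k, seq (k + 1) = nxt (seq k) := fun k => rfl
  have hi : StrictMono fun k => (seq k).1.1 := strictMono_nat_of_lt_succ fun k => by
    rw [seq_succ]; exact hlt_i (seq k)
  have hj : StrictMono fun k => (seq k).1.2 := strictMono_nat_of_lt_succ fun k => by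
    rw [seq_succ]; exact hlt_j (seq k)
  refine ⟨fun k => (seq k).1.1, fun k => (seq k).1.2, hi, hj, fun k => (seq k).2, fun k => g (seq k), fun k => ?_,
    fun k => ?_⟩
  · exact hgf (seq k)
  · exact hfg (seq k)

/-- **[EtTh] Rmk. 2.15.2, second sentence, with print's hypothesis verbatim** («cofinal [i.e., among the connected objects
of `T`] projective systems of connected Galois objects … indexed by ℕ»): for any topological group `Π` and any two
ℕ-indexed projective systems of connected Galois objects of `B^temp(Π)`, each cofinal among the connected objects, there
is an isomorphism of projective systems in the interleaving form of `exists_interleaving_of_cofinal_galois_systems`.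
[cite: MochizukiEtTh2009, Rmk 2.15.2 p.53] -/
theorem exists_interleaving_of_cofinal_galois_systems' (A B : ℕᵒᵖ ⥤ BTemp G)
    (hA : ∀ n : ℕ, IsGaloisObj (A.obj (op n))) (hB : ∀ n : ℕ, IsGaloisObj (B.obj (op n)))
    (hAc : ∀ T : BTemp G, IsConnectedObj T → ∃ n : ℕ, Nonempty (A.obj (op n) ⟶ T))
    (hBc : ∀ T : BTemp G, IsConnectedObj T → ∃ n : ℕ, Nonempty (B.obj (op n) ⟶ T)) :
    ∃ (i j : ℕ → ℕ) (hi : StrictMono i) (hj : StrictMono j)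
      (f : ∀ k : ℕ, A.obj (op (i k)) ⟶ B.obj (op (j k)))
      (g : ∀ k : ℕ, B.obj (op (j (k + 1))) ⟶ A.obj (op (i k))),
      (∀ k, g k ≫ f k = B.map (homOfLE (hj.monotone (Nat.le_succ k))).op) ∧
      (∀ k, f (k + 1) ≫ g k = A.map (homOfLE (hi.monotone (Nat.le_succ k))).op) :=
  exists_interleaving_of_cofinal_galois_systems A B hA hB
    (exists_hom_of_cofinal A B hAc fun n => (hB n).1) (exists_hom_of_cofinal B A hBc fun n => (hA n).1)

end Rmk2152

end Literature.AnabelianGeometry.EtaleTheta
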